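import Summits.QuantumFields.YangMills.Theorems.UniversalDetectorTorusPeriodicity
import Summits.QuantumFields.YangMills.Theorems.UniversalDetectorQ2ThetaReindex

/-!
# Route `UniversalDetector`, support item `PlaneLimitExtraction` (stmt-QuantumFields-23251) — the one-step
defect bound `E = s⁸ ω(s)` from (TIGHT6) at reflected charged pairs

Ideator seat ym-idea-8 g7 (LINE 4 of rung R2a = `BalabanLadder.NT`).  Discharges the hypothesis `hstep` of
`Q2_thetaTest_ge_neg_defect` (`UniversalDetectorRPDefect`) from the inner statement of (TIGHT6) at one coupling:
for lattice points `x, y` of the physical slab `t₀ ≤ s x₀, s y₀ ≤ T` on the odd torus `2L+1` with `2T + s ≤ sL`,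
the reflected arguments `z = ϑx - y` and `z - e₀` are replaced by their centred representatives in `box 4 L`
(periodicity, `cov_plane_cRep`), which keep the time coordinates (`cRep_proj_apply_of_mem`: no time wrap), hence
stay `2t₀`-separated from the origin in physical units and differ exactly by `e₀` (`cRep_proj_sub_single`), so the
equicontinuity modulus of (TIGHT6) at `η = 2t₀` bounds the kernel difference by `ω(‖s e₀‖) = ω(s)`
(`norm_smul_siteToE_single`), i.e. the covariance difference by `s⁸ ω(s)` (`rp_step_bound_of_tight6`).
No summit, rung or crux is proved here.
-/

set_option autoImplicit false

noncomputable section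

open scoped SchwartzMap
open MeasureTheory Filter Topology
open Literature.MathematicalPhysics.QuantumFieldTheory Literature.MathematicalPhysics.QuantumLattice
  Literature.Probability.LatticeModels
open Summit.QuantumFields.YangMills.Cruxes.OSLegsFromFemtoAndGap.DlrCollarTransfer

namespace Summit.QuantumFields.YangMills.Cruxes.UniversalDetectorPlaneTight

variable {G : Type} [Group G] [TopologicalSpace G] [IsTopologicalGroup G] [CompactSpace G]
  [MeasurableSpace G] [BorelSpace G] (r : LatticeRep G)

omit [Group G] [TopologicalSpace G] [IsTopologicalGroup G] [CompactSpace G] [MeasurableSpace G] [BorelSpace G] r in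
/-- `‖s e₀‖ = s` for the lattice unit time vector read in physical units (`s ≥ 0`). -/
theorem norm_smul_siteToE_single {s : ℝ} (hs : 0 ≤ s) :
    ‖s • siteToE (Pi.single (0 : Fin 4) (1 : ℤ) : Site 4)‖ = s := by
  have h : ‖siteToE (Pi.single (0 : Fin 4) (1 : ℤ) : Site 4)‖ = 1 := by
    rw [EuclideanSpace.norm_eq]
    simp [siteToE_apply, Pi.single_apply]
  rw [norm_smul, Real.norm_of_nonneg hs, h, mul_one]

omit [Group G] [TopologicalSpace G] [IsTopologicalGroup G] [CompactSpace G] [MeasurableSpace G] [BorelSpace G] r in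
/-- **No time wrap ⇒ the representatives of `z` and `z - e₀` differ by `e₀`.** -/
theorem cRep_proj_sub_single (L : ℕ) (z : Site 4) (hz : -(L : ℤ) ≤ z 0 ∧ z 0 ≤ L)
    (hz' : -(L : ℤ) ≤ z 0 - 1 ∧ z 0 - 1 ≤ L) :
    Torus.cRep (Torus.proj (2 * L + 1) z) - Torus.cRep (Torus.proj (2 * L + 1) (z - Pi.single 0 1)) =
      Pi.single 0 1 := by
  funext i
  by_cases hi : i = 0
  · subst hi
    have h1 := cRep_proj_apply_of_mem L z 0 hz
    have h2 := cRep_proj_apply_of_mem L (z - Pi.single 0 1) 0 (by simpa using hz')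
    rw [Pi.sub_apply, h1, h2, Pi.sub_apply, Pi.single_eq_same]
    ring
  · rw [Pi.sub_apply, Pi.single_eq_of_ne hi]
    simp [Torus.cRep, Torus.proj_apply, Pi.sub_apply, Pi.single_eq_of_ne hi]

/-- **The one-step defect bound from (TIGHT6).**  At one coupling (`s = a(β)`), the inner statement of (TIGHT6) for
the orientations `p, q` at `η = 2t₀` bounds, for every pair of lattice points of the slab `t₀ ≤ s x₀, s y₀ ≤ T`
(`0 < t₀`, `0 < s`, `2T + s ≤ sL`), the one-step time difference of the plane-resolved truncated kernel at the
reflected pair by `s⁸ ω(s)` (`0 ≤ ω(s)`; the spatial orientations have no step). -/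
theorem rp_step_bound_of_tight6 (β : ℝ) (L : ℕ) {s t₀ T : ℝ} (hs : 0 < s) (ht₀ : 0 < t₀)
    (hLT : 2 * T + s ≤ s * L) (p q : Fin 4 × Fin 4) (C : ℝ) (ω : ℝ → ℝ) (hω0 : 0 ≤ ω s)
    (hT6 : ∀ z ∈ box 4 L, 2 * t₀ ≤ ‖s • siteToE z‖ →
      |s⁻¹ ^ 8 * (torusE G r β L (fun U => plane G r p 0 U * plane G r q z U) -
          torusE G r β L (plane G r p 0) * torusE G r β L (plane G r q z))| ≤ C ∧
        ∀ z' ∈ box 4 L, 2 * t₀ ≤ ‖s • siteToE z'‖ →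
          |s⁻¹ ^ 8 * (torusE G r β L (fun U => plane G r p 0 U * plane G r q z U) -
              torusE G r β L (plane G r p 0) * torusE G r β L (plane G r q z)) -
            s⁻¹ ^ 8 * (torusE G r β L (fun U => plane G r p 0 U * plane G r q z' U) -
              torusE G r β L (plane G r p 0) * torusE G r β L (plane G r q z'))| ≤
            ω ‖s • siteToE z - s • siteToE z'‖)
    {x y : Site 4} (hx : t₀ ≤ s * (x 0 : ℝ)) (hx' : s * (x 0 : ℝ) ≤ T) (hy : t₀ ≤ s * (y 0 : ℝ))
    (hy' : s * (y 0 : ℝ) ≤ T) :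
    |(torusE G r β L (fun V => plane G r p 0 V * plane G r q (siteReflect x - y) V) -
        torusE G r β L (plane G r p 0) * torusE G r β L (plane G r q (siteReflect x - y))) -
      (torusE G r β L (fun V => plane G r p 0 V *
          plane G r q ((if q.1 = 0 then siteReflect x - Pi.single 0 1 else siteReflect x) - y) V) -
        torusE G r β L (plane G r p 0) *
          torusE G r β L (plane G r q ((if q.1 = 0 then siteReflect x - Pi.single 0 1 else siteReflect x) - y)))|
      ≤ s ^ 8 * ω s := by
  by_cases hq : q.1 = 0
  swap
  · rw [if_neg hq, sub_self, abs_zero]; positivity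
  rw [if_pos hq, show siteReflect x - Pi.single 0 1 - y = (siteReflect x - y) - Pi.single 0 1 from sub_right_comm _ _ _]
  set z : Site 4 := siteReflect x - y with hzdef
  -- integer time bounds (no time wrap)
  have hx0 : (0 : ℝ) < x 0 := by
    by_contra h; push Not at h; nlinarith
  have hy0 : (0 : ℝ) < y 0 := by
    by_contra h; push Not at h; nlinarith
  have hsum : (x 0 : ℝ) + y 0 + 1 ≤ L := by
    have h1 : s * ((x 0 : ℝ) + y 0 + 1) ≤ s * L := by nlinarith
    exact le_of_mul_le_mul_left h1 hs
  have hz0 : z 0 = -x 0 - y 0 := by rw [hzdef, Pi.sub_apply, siteReflect_apply_zero]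
  have hsumZ : x 0 + y 0 + 1 ≤ (L : ℤ) := by exact_mod_cast hsum
  have hx0Z : 0 < x 0 := by exact_mod_cast hx0
  have hy0Z : 0 < y 0 := by exact_mod_cast hy0
  have hzw : -(L : ℤ) ≤ z 0 ∧ z 0 ≤ L := by rw [hz0]; constructor <;> omega
  have hzw' : -(L : ℤ) ≤ z 0 - 1 ∧ z 0 - 1 ≤ L := by rw [hz0]; constructor <;> omega
  -- centred representatives
  set zh : Site 4 := Torus.cRep (Torus.proj (2 * L + 1) z) with hzh
  set zh' : Site 4 := Torus.cRep (Torus.proj (2 * L + 1) (z - Pi.single 0 1)) with hzh'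
  have hmem : zh ∈ box 4 L := cRep_proj_mem_box L z
  have hmem' : zh' ∈ box 4 L := cRep_proj_mem_box L (z - Pi.single 0 1)
  have ht : zh 0 = z 0 := cRep_proj_apply_of_mem L z 0 hzw
  have ht' : zh' 0 = z 0 - 1 := by
    have := cRep_proj_apply_of_mem L (z - Pi.single 0 1) 0 (by simpa using hzw')
    simpa using this
  -- `a |v 0| ≤ ‖a • v‖`
  have key : ∀ v : Site 4, s * |(v 0 : ℝ)| ≤ ‖s • siteToE v‖ := fun v => by
    rw [norm_smul, Real.norm_of_nonneg hs.le]
    gcongr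
    simpa [siteToE_apply, Real.norm_eq_abs] using PiLp.norm_apply_le (siteToE v) 0
  have hann : 2 * t₀ ≤ ‖s • siteToE zh‖ := by
    refine le_trans ?_ (key zh)
    rw [ht, hz0]; push_cast
    rw [show -(x 0 : ℝ) - y 0 = -((x 0 : ℝ) + y 0) by ring, abs_neg, abs_of_pos (by linarith)]
    nlinarith
  have hann' : 2 * t₀ ≤ ‖s • siteToE zh'‖ := by
    refine le_trans ?_ (key zh')
    rw [ht', hz0]; push_cast
    rw [show -(x 0 : ℝ) - y 0 - 1 = -((x 0 : ℝ) + y 0 + 1) by ring, abs_neg, abs_of_pos (by linarith)]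
    nlinarith
  have hdist : ‖s • siteToE zh - s • siteToE zh'‖ = s := by
    have hsub : zh - zh' = Pi.single 0 1 := cRep_proj_sub_single L z hzw hzw'
    have : s • siteToE zh - s • siteToE zh' = s • siteToE (zh - zh') := by
      rw [← smul_sub]; congr 1; ext i; simp [siteToE_apply]
    rw [this, hsub, norm_smul_siteToE_single hs.le]
  -- (TIGHT6) at the representatives
  have hk := ((hT6 zh hmem hann).2 zh' hmem' hann')
  rw [hdist] at hk
  -- back to the unreduced arguments by periodicity
  have e1 := cov_plane_cRep r β L p q 0 z
  have e2 := cov_plane_cRep r β L p q 0 (z - Pi.single 0 1)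
  rw [← hzh] at e1
  rw [← hzh'] at e2
  rw [← e1, ← e2, abs_sub_eq_pow_mul_abs_sub_scaled hs.ne']
  exact mul_le_mul_of_nonneg_left hk (by positivity)

end Summit.QuantumFields.YangMills.Cruxes.UniversalDetectorPlaneTight

end
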